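import Summits.ResolutionOfSingularities.ResolutionOfSingularities.Theses.Descent
import Summits.ResolutionOfSingularities.ResolutionOfSingularities.Theses.EscapeRate
import Summits.ResolutionOfSingularities.ResolutionOfSingularities.Theorems.RadicialJungCleanResolvesProof
import Summits.ResolutionOfSingularities.ResolutionOfSingularities.Theorems.PAlterationPicoverDegPDimLeThree
import Summits.ResolutionOfSingularities.ResolutionOfSingularities.Theorems.WeightedInvariantDescentPerfectToAllOneRootCoreReduction
import Summits.ResolutionOfSingularities.ResolutionOfSingularities.Theorems.WeightedInvariantDescentPerfectToAllPicoverLink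
import Summits.ResolutionOfSingularities.ResolutionOfSingularities.Theorems.RadicialJungCleanModelsSufficeFrame
import Literature.AlgebraicGeometry.Resolution.NormalizationInExtension
import HarnessLib

/-!
# Crux `DescentPerfectToAll` (stmt-ResolutionOfSingularities-0549) — support glue G1″:
# the ANTECEDENT-HONEST chain `CossartPiltant2019 + (PerfectRes_p ⟹ CleanModels|_{dim W ≥ 4, k imperfect}) ⟹ DescentPerfectToAll`

Port to `Theorems/` of the sorry-free core of the lens workfile `Cruxes/DescentPerfectToAll/Lines/via_cp_frame.lean`
(rev 2.3, res-B-lens-5 g4; section `Rev23Core`), adopted as the rung-B price wording of record by director ruling DR-B3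
(registrar #4h): «rung B = `CleanModels`|_{dim W ≥ 4, ground field k IMPERFECT}, guarded by the crux antecedent
`PerfectRes_p`, modulo CP 2019 Thm 1.1 (`CossartPiltant2019`)».  The landed G1
(`Theorems.descentPerfectToAll_of_cleanModelsDimGEFour`, `DescentDescentPerfectToAllOfCleanModelsDimGEFour.lean`) reaches
the crux from `CleanModels|_{dim W ≥ 4}` over ALL ground fields of characteristic `p`; G1″ removes the perfect-field half
of that hypothesis, using the crux's own antecedent instead.

The point (no new mathematics): the chain `CleanModels ⟹ Picover ⟹ DescentPerfectToAll` needs clean models ONLY to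
produce the degree-`p` residue `DegP_p(k; W, L)` («the normalisation `W^L` of a regular integral separated finite-type
`k`-scheme `W` in a degree-`p` purely inseparable extension `L/K(W)` has a resolution»), and `DegP_p` splits three ways:
* `k` PERFECT: `DegP_p` is literally an instance of the antecedent `PerfectRes_p` applied to `W^L` itself (integral,
  hence reduced; separated and of finite type over `k` because `W^L → W` is finite, `isFinite_normalizationInι`) — no
  cleaning, no Cossart–Piltant, every dimension;
* `dim W ≤ 3`: the solved sibling, `Picover.DegPDimLeThree.picoverDegP_of_dim_le_three` (the named fact
  `CossartPiltant2019`; `dim W^L = dim W`);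
* otherwise (`k` imperfect, `dim W ≥ 4`): a pointwise log-clean regular model from the IMPERFECT-ground-field statement
  and the proved item `RadicialJung.CleanResolves` (`cleanResolves_proof`, stmt-16286).
Then Temkin's degree-`p` tower (`RadicialJung.CleanModelsSuffice.picoverAt_of_degPAt`) gives `PICover_p`, the proved
item `PicoverToRadicialBottom` (`picoverToRadicialBottom_proof`, stmt-0556) the radicial bottom at `p`,
`oneRootStepCore_of_radicialBottom` the one-root core at `p`, and `descentPerfectToAll_of_oneRootStepCore` (irreducible
components, geometric integrality, perfect closure, limit descent, radicial tower) the crux.  Because the antecedent is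
needed INSIDE `DegP_p`, the chain is threaded per prime through the one-root core (which hands the antecedent at `p` to
its hypothesis) rather than through the all-primes `descentPerfectToAll_of_picover`.

## Content (namespace `Summit.ResolutionOfSingularities.ResolutionOfSingularities.Theorems`; every hypothesis is
## stated INLINE — the bodies, verbatim, of the workfile's `PerfectResAt p`, `CleanModelsDimGEFourImperfectAt p`,
## `CleanModelsDimGEFourPerfectAt p` (pointwise clause `LineCleanAlong` unfolded) and of G1's `CleanModels|_{dim ≥ 4}`)
* `degP_of_perfectResAt_of_cleanModelsImperfectAt` — the three-way split: `DegP_p` at a fixed prime;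
* `picoverAt_of_perfectResAt_of_cleanModelsImperfectAt` — `PICover_p` at a fixed prime;
* `descentPerfectToAll_of_cleanModelsImperfect` — **G1″**, concluding the item's decl `Theses.Descent.DescentPerfectToAll`,
  with the `EscapeRate` copy `escapeRate_descentPerfectToAll_of_cleanModelsImperfect` (the decl the registered 0549
  skeleton concludes) and the guard-free variant `descentPerfectToAll_of_cleanModelsImperfect_unguarded`;
* `cleanModelsDimGEFour_iff_perfectAt_and_imperfectAt` — G1's hypothesis `CleanModels|_{dim W ≥ 4}` is the conjunction of
  its perfect-field half and its imperfect-field half (excluded middle on `PerfectField k`); only the imperfect half,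
  guarded by the antecedent, is load-bearing for rung B (G1 is G1″ ∘ `.2` of this split: weaker hypothesis, same
  conclusion).

Honest framing: nothing here proves resolution of singularities in characteristic `p`.  `CossartPiltant2019` is an
undischarged named fact of the tree (hypothesis `hCP`); `CleanModels|_{dim W ≥ 4, k imperfect}` — even guarded by
`PerfectRes_p` — is OPEN and ON `Literature.Barriers.ResolutionOfSingularities.DimensionFourFrontier`; «imperfect» is a
restriction AS TYPED (an instance over an imperfect `k` may encode perfect-field geometry, `W₀ ⊗_{𝔽_p} 𝔽_p(t)`), and the
guard does NOT pay the imperfect case by base change (crux Disproof §3).  This file only records, kernel-checked, that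
rung B's price no longer includes any cleaning over perfect ground fields.  [OURS · CANDIDATE] counted 0.
-/

noncomputable section

set_option linter.dupNamespace false -- mandated namespace of this single-conjunct summit

open CategoryTheory AlgebraicGeometry
open Literature.AlgebraicGeometry.Resolution

namespace Summit.ResolutionOfSingularities.ResolutionOfSingularities.Theorems

/-- **`DegP_p` from the antecedent, the solved sibling and the imperfect-field clean models (three-way split).**  For a
prime `p`, a field `k` of characteristic `p`, a regular integral `W` separated of finite type over `k` and a purely
inseparable `L/K(W)` of degree `p`, the normalisation `W^L` has a resolution: if `k` is PERFECT, by the antecedent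
`PerfectRes_p` (hypothesis `H`, verbatim the crux's hypothesis at `p`) applied to `W^L` itself — integral hence reduced,
separated and of finite type over `k` since `W^L → W` is finite (`isFinite_normalizationInι`); else if `dim W ≤ 3`, by
Cossart–Piltant (`Picover.DegPDimLeThree.picoverDegP_of_dim_le_three`); else by the pointwise log-clean regular model of
the imperfect-ground-field hypothesis `h4` (verbatim `CleanModels|_{dim W ≥ 4}` at `p` with `¬ PerfectField k`) and the
proved item `RadicialJung.CleanResolves` (`cleanResolves_proof`). [cite: CossartPiltant2019, Thm. 1.1] -/
theorem degP_of_perfectResAt_of_cleanModelsImperfectAt (hCP : CossartPiltant2019.{0}) (p : ℕ) (hp : p.Prime)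
    (H : ∀ (κ : Type) [Field κ] [CharP κ p] [PerfectField κ] (Z : Scheme.{0}) (h : Z ⟶ Spec (.of κ)),
      IsSeparated h → LocallyOfFiniteType h → QuasiCompact h → IsReduced Z → Scheme.HasResolution Z)
    (h4 : ∀ (k : Type) [Field k] [CharP k p], ¬ PerfectField k → ∀ (W : Scheme.{0}) [IsIntegral W]
      (f : W ⟶ Spec (.of k)) (L : Type) [Field L] [Algebra W.functionField L],
      IsSeparated f → LocallyOfFiniteType f → QuasiCompact f → Literature.AlgebraicGeometry.Resolution.Scheme.IsRegular W →
      IsPurelyInseparable W.functionField L → Module.finrank W.functionField L = p → ¬ topologicalKrullDim W ≤ 3 →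
      ∃ (V : Scheme.{0}) (π : V ⟶ W) (_ : IsIntegral V) (_ : IsDominant π),
        IsProper π ∧ Literature.AlgebraicGeometry.Resolution.IsBirational π ∧
        Literature.AlgebraicGeometry.Resolution.Scheme.IsRegular V ∧ ∀ v : V,
          ∃ (y : L) (g : W.functionField), y ∉ Set.range (algebraMap W.functionField L) ∧
            algebraMap W.functionField L g = y ^ p ∧
            ((∃ (d m : ℕ) (hmd : m ≤ d) (t : Fin d → V.presheaf.stalk v) (a : Fin m → ℕ),
                Ideal.span (Set.range t) = IsLocalRing.maximalIdeal (V.presheaf.stalk v) ∧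
                ringKrullDim (V.presheaf.stalk v) = (d : WithBot ℕ∞) ∧ 0 < m ∧ (∀ i, ¬ p ∣ a i) ∧
                Literature.AlgebraicGeometry.Motives.RatFn.functionFieldMap π g =
                  ∏ i : Fin m, (algebraMap (V.presheaf.stalk v) V.functionField (t (Fin.castLE hmd i))) ^ (a i)) ∨
             (∃ u₀ : V.presheaf.stalk v, IsUnit u₀ ∧
                Literature.AlgebraicGeometry.Motives.RatFn.functionFieldMap π g =
                  algebraMap (V.presheaf.stalk v) V.functionField u₀ ∧
                ((∀ c : V.presheaf.stalk v, u₀ - c ^ p ∉ IsLocalRing.maximalIdeal (V.presheaf.stalk v)) ∨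
                 (∃ c : V.presheaf.stalk v, u₀ - c ^ p ∈ IsLocalRing.maximalIdeal (V.presheaf.stalk v) ∧
                    u₀ - c ^ p ∉ IsLocalRing.maximalIdeal (V.presheaf.stalk v) ^ 2))))) :
    ∀ (k : Type) [Field k] [CharP k p] (W : Scheme.{0}) [IsIntegral W]
      (f : W ⟶ Spec (.of k)) (L : Type) [Field L] [Algebra W.functionField L],
      IsSeparated f → LocallyOfFiniteType f → QuasiCompact f → Scheme.IsRegular W →
      IsPurelyInseparable W.functionField L → Module.finrank W.functionField L = p →
      Scheme.HasResolution (normalizationIn W L) := by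
  intro k _ _ W _ f L _ _ hs hl hq hr hpi hd
  by_cases hk : PerfectField k
  · -- perfect ground field: the ANTECEDENT resolves `W^L` (no cleaning, every dimension)
    haveI : FiniteDimensional W.functionField L := Module.finite_of_finrank_pos (by rw [hd]; exact hp.pos)
    haveI := hs; haveI := hl; haveI := hq
    haveI : IsFinite (normalizationInι W L) := isFinite_normalizationInι W L f
    haveI : IsSeparated (normalizationInι W L ≫ f) := inferInstance
    haveI : LocallyOfFiniteType (normalizationInι W L ≫ f) := inferInstance
    haveI : QuasiCompact (normalizationInι W L ≫ f) := inferInstance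
    exact H k (normalizationIn W L) (normalizationInι W L ≫ f) inferInstance inferInstance inferInstance inferInstance
  · by_cases hdim : topologicalKrullDim W ≤ 3
    · -- the solved sibling (Cossart–Piltant 2019, `dim ≤ 3`, arbitrary fields)
      exact Picover.DegPDimLeThree.picoverDegP_of_dim_le_three hCP p hp k W f L hs hl hq hr hpi hd hdim
    · -- imperfect ground field, `dim W ≥ 4`: pointwise log-clean regular model + `CleanResolves` (proved)
      obtain ⟨V, π, hVi, hdom, hV⟩ := h4 k hk W f L hs hl hq hr hpi hd hdim
      exact cleanResolves_proof p hp k W f L hs hl hq hr hpi hd V π hV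

/-- **`PICover_p` from the antecedent, the sibling and the imperfect-field clean models**: the degree-`p` residue of
`degP_of_perfectResAt_of_cleanModelsImperfectAt` fed to Temkin's degree-`p` tower
`RadicialJung.CleanModelsSuffice.picoverAt_of_degPAt`.  The conclusion is verbatim route pAlteration's crux `Picover`
(stmt-0554) at the prime `p`. [cite: Temkin2013, Rem. 1.3.5 (ii)] -/
theorem picoverAt_of_perfectResAt_of_cleanModelsImperfectAt (hCP : CossartPiltant2019.{0}) (p : ℕ) (hp : p.Prime)
    (H : ∀ (κ : Type) [Field κ] [CharP κ p] [PerfectField κ] (Z : Scheme.{0}) (h : Z ⟶ Spec (.of κ)),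
      IsSeparated h → LocallyOfFiniteType h → QuasiCompact h → IsReduced Z → Scheme.HasResolution Z)
    (h4 : ∀ (k : Type) [Field k] [CharP k p], ¬ PerfectField k → ∀ (W : Scheme.{0}) [IsIntegral W]
      (f : W ⟶ Spec (.of k)) (L : Type) [Field L] [Algebra W.functionField L],
      IsSeparated f → LocallyOfFiniteType f → QuasiCompact f → Literature.AlgebraicGeometry.Resolution.Scheme.IsRegular W →
      IsPurelyInseparable W.functionField L → Module.finrank W.functionField L = p → ¬ topologicalKrullDim W ≤ 3 →
      ∃ (V : Scheme.{0}) (π : V ⟶ W) (_ : IsIntegral V) (_ : IsDominant π),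
        IsProper π ∧ Literature.AlgebraicGeometry.Resolution.IsBirational π ∧
        Literature.AlgebraicGeometry.Resolution.Scheme.IsRegular V ∧ ∀ v : V,
          ∃ (y : L) (g : W.functionField), y ∉ Set.range (algebraMap W.functionField L) ∧
            algebraMap W.functionField L g = y ^ p ∧
            ((∃ (d m : ℕ) (hmd : m ≤ d) (t : Fin d → V.presheaf.stalk v) (a : Fin m → ℕ),
                Ideal.span (Set.range t) = IsLocalRing.maximalIdeal (V.presheaf.stalk v) ∧
                ringKrullDim (V.presheaf.stalk v) = (d : WithBot ℕ∞) ∧ 0 < m ∧ (∀ i, ¬ p ∣ a i) ∧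
                Literature.AlgebraicGeometry.Motives.RatFn.functionFieldMap π g =
                  ∏ i : Fin m, (algebraMap (V.presheaf.stalk v) V.functionField (t (Fin.castLE hmd i))) ^ (a i)) ∨
             (∃ u₀ : V.presheaf.stalk v, IsUnit u₀ ∧
                Literature.AlgebraicGeometry.Motives.RatFn.functionFieldMap π g =
                  algebraMap (V.presheaf.stalk v) V.functionField u₀ ∧
                ((∀ c : V.presheaf.stalk v, u₀ - c ^ p ∉ IsLocalRing.maximalIdeal (V.presheaf.stalk v)) ∨
                 (∃ c : V.presheaf.stalk v, u₀ - c ^ p ∈ IsLocalRing.maximalIdeal (V.presheaf.stalk v) ∧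
                    u₀ - c ^ p ∉ IsLocalRing.maximalIdeal (V.presheaf.stalk v) ^ 2))))) :
    ∀ (k : Type) [Field k] [CharP k p] (Y X : Scheme.{0}) (f : Y ⟶ Spec (.of k)) (g : X ⟶ Y),
      IsSeparated f → LocallyOfFiniteType f → QuasiCompact f → IsIntegral Y → Scheme.IsRegular Y → IsIntegral X →
      IsFinite g → UniversallyInjective g → Function.Surjective g.base → Scheme.HasResolution X := by
  intro k _ _ Y X f g hsep hlft hqc hY hYreg hX hfin hui hsurj
  exact RadicialJung.CleanModelsSuffice.picoverAt_of_degPAt p hp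
    (degP_of_perfectResAt_of_cleanModelsImperfectAt hCP p hp H h4) k Y X f g hsep hlft hqc hY hYreg hX hfin hui hsurj

/-- **G1″ — the antecedent-honest glue: Cossart–Piltant + (`PerfectRes_p ⟹ CleanModels|_{dim W ≥ 4, k imperfect}` for
every prime `p`) ⟹ `DescentPerfectToAll`** (the item's own decl `Theses.Descent.DescentPerfectToAll`, crux
stmt-ResolutionOfSingularities-0549).  The hypothesis `h4` is, for each prime `p`, verbatim «the crux's antecedent at `p`»
→ «`CleanModels|_{dim W ≥ 4}` at `p` over ground fields `k` with `¬ PerfectField k`».  Chain, all landed: `PICover_p`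
(`picoverAt_of_perfectResAt_of_cleanModelsImperfectAt`) ⟹ radicial bottom at `p` (`picoverToRadicialBottom_proof`,
stmt-0556) ⟹ one-root core at `p` (`oneRootStepCore_of_radicialBottom`) ⟹ the crux
(`descentPerfectToAll_of_oneRootStepCore`).  The antecedent is consumed twice: by the one-root reduction and, inside
`DegP_p`, over perfect ground fields.  Rung B is thereby priced by `CleanModels|_{dim W ≥ 4, k imperfect}` guarded by
`PerfectRes_p`, modulo the named fact `CossartPiltant2019`; it is not paid. [cite: CossartPiltant2019, Thm. 1.1] -/
theorem descentPerfectToAll_of_cleanModelsImperfect (hCP : CossartPiltant2019.{0})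
    (h4 : ∀ p : ℕ, p.Prime →
      (∀ (κ : Type) [Field κ] [CharP κ p] [PerfectField κ] (Z : Scheme.{0}) (h : Z ⟶ Spec (.of κ)),
        IsSeparated h → LocallyOfFiniteType h → QuasiCompact h → IsReduced Z → Scheme.HasResolution Z) →
      ∀ (k : Type) [Field k] [CharP k p], ¬ PerfectField k → ∀ (W : Scheme.{0}) [IsIntegral W]
        (f : W ⟶ Spec (.of k)) (L : Type) [Field L] [Algebra W.functionField L],
        IsSeparated f → LocallyOfFiniteType f → QuasiCompact f → Literature.AlgebraicGeometry.Resolution.Scheme.IsRegular W →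
        IsPurelyInseparable W.functionField L → Module.finrank W.functionField L = p → ¬ topologicalKrullDim W ≤ 3 →
        ∃ (V : Scheme.{0}) (π : V ⟶ W) (_ : IsIntegral V) (_ : IsDominant π),
          IsProper π ∧ Literature.AlgebraicGeometry.Resolution.IsBirational π ∧
          Literature.AlgebraicGeometry.Resolution.Scheme.IsRegular V ∧ ∀ v : V,
            ∃ (y : L) (g : W.functionField), y ∉ Set.range (algebraMap W.functionField L) ∧
              algebraMap W.functionField L g = y ^ p ∧
              ((∃ (d m : ℕ) (hmd : m ≤ d) (t : Fin d → V.presheaf.stalk v) (a : Fin m → ℕ),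
                  Ideal.span (Set.range t) = IsLocalRing.maximalIdeal (V.presheaf.stalk v) ∧
                  ringKrullDim (V.presheaf.stalk v) = (d : WithBot ℕ∞) ∧ 0 < m ∧ (∀ i, ¬ p ∣ a i) ∧
                  Literature.AlgebraicGeometry.Motives.RatFn.functionFieldMap π g =
                    ∏ i : Fin m, (algebraMap (V.presheaf.stalk v) V.functionField (t (Fin.castLE hmd i))) ^ (a i)) ∨
               (∃ u₀ : V.presheaf.stalk v, IsUnit u₀ ∧
                  Literature.AlgebraicGeometry.Motives.RatFn.functionFieldMap π g =
                    algebraMap (V.presheaf.stalk v) V.functionField u₀ ∧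
                  ((∀ c : V.presheaf.stalk v, u₀ - c ^ p ∉ IsLocalRing.maximalIdeal (V.presheaf.stalk v)) ∨
                   (∃ c : V.presheaf.stalk v, u₀ - c ^ p ∈ IsLocalRing.maximalIdeal (V.presheaf.stalk v) ∧
                      u₀ - c ^ p ∉ IsLocalRing.maximalIdeal (V.presheaf.stalk v) ^ 2))))) :
    Summit.ResolutionOfSingularities.ResolutionOfSingularities.Theses.Descent.DescentPerfectToAll :=
  fun p hp H =>
    (descentPerfectToAll_of_oneRootStepCore fun q hq Hq =>
      oneRootStepCore_of_radicialBottom q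
        (picoverToRadicialBottom_proof q hq.out
          (picoverAt_of_perfectResAt_of_cleanModelsImperfectAt hCP q hq.out Hq (h4 q hq.out Hq)))) p hp H

/-- G1″ concluding the `EscapeRate` copy of the crux (rfl-equal to the `Descent` decl; the decl concluded by
`DescentPerfectToAll_of` in the registered 0549 skeleton `Cruxes/DescentPerfectToAll/Lines/via_clean_models.lean` and in
the lens workfile `via_cp_frame.lean`). [cite: CossartPiltant2019, Thm. 1.1] -/
theorem escapeRate_descentPerfectToAll_of_cleanModelsImperfect (hCP : CossartPiltant2019.{0})
    (h4 : ∀ p : ℕ, p.Prime →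
      (∀ (κ : Type) [Field κ] [CharP κ p] [PerfectField κ] (Z : Scheme.{0}) (h : Z ⟶ Spec (.of κ)),
        IsSeparated h → LocallyOfFiniteType h → QuasiCompact h → IsReduced Z → Scheme.HasResolution Z) →
      ∀ (k : Type) [Field k] [CharP k p], ¬ PerfectField k → ∀ (W : Scheme.{0}) [IsIntegral W]
        (f : W ⟶ Spec (.of k)) (L : Type) [Field L] [Algebra W.functionField L],
        IsSeparated f → LocallyOfFiniteType f → QuasiCompact f → Literature.AlgebraicGeometry.Resolution.Scheme.IsRegular W →
        IsPurelyInseparable W.functionField L → Module.finrank W.functionField L = p → ¬ topologicalKrullDim W ≤ 3 →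
        ∃ (V : Scheme.{0}) (π : V ⟶ W) (_ : IsIntegral V) (_ : IsDominant π),
          IsProper π ∧ Literature.AlgebraicGeometry.Resolution.IsBirational π ∧
          Literature.AlgebraicGeometry.Resolution.Scheme.IsRegular V ∧ ∀ v : V,
            ∃ (y : L) (g : W.functionField), y ∉ Set.range (algebraMap W.functionField L) ∧
              algebraMap W.functionField L g = y ^ p ∧
              ((∃ (d m : ℕ) (hmd : m ≤ d) (t : Fin d → V.presheaf.stalk v) (a : Fin m → ℕ),
                  Ideal.span (Set.range t) = IsLocalRing.maximalIdeal (V.presheaf.stalk v) ∧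
                  ringKrullDim (V.presheaf.stalk v) = (d : WithBot ℕ∞) ∧ 0 < m ∧ (∀ i, ¬ p ∣ a i) ∧
                  Literature.AlgebraicGeometry.Motives.RatFn.functionFieldMap π g =
                    ∏ i : Fin m, (algebraMap (V.presheaf.stalk v) V.functionField (t (Fin.castLE hmd i))) ^ (a i)) ∨
               (∃ u₀ : V.presheaf.stalk v, IsUnit u₀ ∧
                  Literature.AlgebraicGeometry.Motives.RatFn.functionFieldMap π g =
                    algebraMap (V.presheaf.stalk v) V.functionField u₀ ∧
                  ((∀ c : V.presheaf.stalk v, u₀ - c ^ p ∉ IsLocalRing.maximalIdeal (V.presheaf.stalk v)) ∨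
                   (∃ c : V.presheaf.stalk v, u₀ - c ^ p ∈ IsLocalRing.maximalIdeal (V.presheaf.stalk v) ∧
                      u₀ - c ^ p ∉ IsLocalRing.maximalIdeal (V.presheaf.stalk v) ^ 2))))) :
    Summit.ResolutionOfSingularities.ResolutionOfSingularities.Theses.EscapeRate.DescentPerfectToAll :=
  fun p hp H => descentPerfectToAll_of_cleanModelsImperfect hCP h4 p hp H

/-- G1″ with the guard dropped: Cossart–Piltant + `CleanModels|_{dim W ≥ 4, k imperfect}` at every prime (no antecedent)
⟹ `DescentPerfectToAll` — what the slot line's stub `stub_cleanModelsDimGEFour` can be weakened to without touching the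
rest of the 0549 skeleton. [cite: CossartPiltant2019, Thm. 1.1] -/
theorem descentPerfectToAll_of_cleanModelsImperfect_unguarded (hCP : CossartPiltant2019.{0})
    (h4 : ∀ p : ℕ, p.Prime →
      ∀ (k : Type) [Field k] [CharP k p], ¬ PerfectField k → ∀ (W : Scheme.{0}) [IsIntegral W]
        (f : W ⟶ Spec (.of k)) (L : Type) [Field L] [Algebra W.functionField L],
        IsSeparated f → LocallyOfFiniteType f → QuasiCompact f → Literature.AlgebraicGeometry.Resolution.Scheme.IsRegular W →
        IsPurelyInseparable W.functionField L → Module.finrank W.functionField L = p → ¬ topologicalKrullDim W ≤ 3 →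
        ∃ (V : Scheme.{0}) (π : V ⟶ W) (_ : IsIntegral V) (_ : IsDominant π),
          IsProper π ∧ Literature.AlgebraicGeometry.Resolution.IsBirational π ∧
          Literature.AlgebraicGeometry.Resolution.Scheme.IsRegular V ∧ ∀ v : V,
            ∃ (y : L) (g : W.functionField), y ∉ Set.range (algebraMap W.functionField L) ∧
              algebraMap W.functionField L g = y ^ p ∧
              ((∃ (d m : ℕ) (hmd : m ≤ d) (t : Fin d → V.presheaf.stalk v) (a : Fin m → ℕ),
                  Ideal.span (Set.range t) = IsLocalRing.maximalIdeal (V.presheaf.stalk v) ∧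
                  ringKrullDim (V.presheaf.stalk v) = (d : WithBot ℕ∞) ∧ 0 < m ∧ (∀ i, ¬ p ∣ a i) ∧
                  Literature.AlgebraicGeometry.Motives.RatFn.functionFieldMap π g =
                    ∏ i : Fin m, (algebraMap (V.presheaf.stalk v) V.functionField (t (Fin.castLE hmd i))) ^ (a i)) ∨
               (∃ u₀ : V.presheaf.stalk v, IsUnit u₀ ∧
                  Literature.AlgebraicGeometry.Motives.RatFn.functionFieldMap π g =
                    algebraMap (V.presheaf.stalk v) V.functionField u₀ ∧
                  ((∀ c : V.presheaf.stalk v, u₀ - c ^ p ∉ IsLocalRing.maximalIdeal (V.presheaf.stalk v)) ∨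
                   (∃ c : V.presheaf.stalk v, u₀ - c ^ p ∈ IsLocalRing.maximalIdeal (V.presheaf.stalk v) ∧
                      u₀ - c ^ p ∉ IsLocalRing.maximalIdeal (V.presheaf.stalk v) ^ 2))))) :
    Summit.ResolutionOfSingularities.ResolutionOfSingularities.Theses.Descent.DescentPerfectToAll :=
  descentPerfectToAll_of_cleanModelsImperfect hCP fun p hp _ => h4 p hp

/-- **G1's hypothesis `CleanModels|_{dim W ≥ 4}` (verbatim the `h4` of `descentPerfectToAll_of_cleanModelsDimGEFour` = the
slot line's research stub `stub_cleanModelsDimGEFour`) is the conjunction of its PERFECT-ground-field half and its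
IMPERFECT-ground-field half** (excluded middle on `PerfectField k`).  After G1″ only the imperfect half, guarded by the
antecedent, is load-bearing for rung B; the perfect half is the critic's off-cut de-risk question («resolution ⟹ clean
models over perfect fields, `dim ≥ 4`»; no precedent in print in any dimension). [folklore] -/
theorem cleanModelsDimGEFour_iff_perfectAt_and_imperfectAt :
    (∀ p : ℕ, p.Prime → ∀ (k : Type) [Field k] [CharP k p] (W : AlgebraicGeometry.Scheme.{0}) [AlgebraicGeometry.IsIntegral W] (f : W ⟶ AlgebraicGeometry.Spec (.of k)) (L : Type) [Field L] [Algebra W.functionField L], AlgebraicGeometry.IsSeparated f → AlgebraicGeometry.LocallyOfFiniteType f → AlgebraicGeometry.QuasiCompact f → Literature.AlgebraicGeometry.Resolution.Scheme.IsRegular W → IsPurelyInseparable W.functionField L → Module.finrank W.functionField L = p → ¬ topologicalKrullDim W ≤ 3 → ∃ (V : AlgebraicGeometry.Scheme.{0}) (π : V ⟶ W) (_ : AlgebraicGeometry.IsIntegral V) (_ : AlgebraicGeometry.IsDominant π), AlgebraicGeometry.IsProper π ∧ Literature.AlgebraicGeometry.Resolution.IsBirational π ∧ Literature.AlgebraicGeometry.Resolution.Scheme.IsRegular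 V ∧ (∀ v : V, (∃ (y : L) (g : W.functionField), y ∉ Set.range (algebraMap W.functionField L) ∧ algebraMap W.functionField L g = y ^ p ∧ ((∃ (d m : ℕ) (hmd : m ≤ d) (t : Fin d → V.presheaf.stalk v) (a : Fin m → ℕ), Ideal.span (Set.range t) = IsLocalRing.maximalIdeal (V.presheaf.stalk v) ∧ ringKrullDim (V.presheaf.stalk v) = (d : WithBot ℕ∞) ∧ 0 < m ∧ (∀ i, ¬ p ∣ a i) ∧ Literature.AlgebraicGeometry.Motives.RatFn.functionFieldMap π g = ∏ i : Fin m, (algebraMap (V.presheaf.stalk v) V.functionField (t (Fin.castLE hmd i))) ^ (a i)) ∨ (∃ u₀ : V.presheaf.stalk v, IsUnit u₀ ∧ Literature.AlgebraicGeometry.Motives.RatFn.functionFieldMap π g = algebraMap (V.presheaf.stalk v) V.functionField u₀ ∧ ((∀ c : V.presheaf.stalk v, u₀ - c ^ p ∉ IsLocalRing.maximalIdeal (V.presheaf.stalk v)) ∨ (∃ c : V.presheaf.stalk v, u₀ - c ^ p ∈ IsLocalRing.maximalIdeal (V.presheaf.stalk v) ∧ u₀ - c ^ p ∉ IsLocalRing.maximalIdeal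 (V.presheaf.stalk v) ^ 2))))))) ↔
      (∀ p : ℕ, p.Prime → ∀ (k : Type) [Field k] [CharP k p], PerfectField k → ∀ (W : Scheme.{0}) [IsIntegral W]
        (f : W ⟶ Spec (.of k)) (L : Type) [Field L] [Algebra W.functionField L],
        IsSeparated f → LocallyOfFiniteType f → QuasiCompact f → Literature.AlgebraicGeometry.Resolution.Scheme.IsRegular W →
        IsPurelyInseparable W.functionField L → Module.finrank W.functionField L = p → ¬ topologicalKrullDim W ≤ 3 →
        ∃ (V : Scheme.{0}) (π : V ⟶ W) (_ : IsIntegral V) (_ : IsDominant π),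
          IsProper π ∧ Literature.AlgebraicGeometry.Resolution.IsBirational π ∧
          Literature.AlgebraicGeometry.Resolution.Scheme.IsRegular V ∧ ∀ v : V,
            ∃ (y : L) (g : W.functionField), y ∉ Set.range (algebraMap W.functionField L) ∧
              algebraMap W.functionField L g = y ^ p ∧
              ((∃ (d m : ℕ) (hmd : m ≤ d) (t : Fin d → V.presheaf.stalk v) (a : Fin m → ℕ),
                  Ideal.span (Set.range t) = IsLocalRing.maximalIdeal (V.presheaf.stalk v) ∧
                  ringKrullDim (V.presheaf.stalk v) = (d : WithBot ℕ∞) ∧ 0 < m ∧ (∀ i, ¬ p ∣ a i) ∧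
                  Literature.AlgebraicGeometry.Motives.RatFn.functionFieldMap π g =
                    ∏ i : Fin m, (algebraMap (V.presheaf.stalk v) V.functionField (t (Fin.castLE hmd i))) ^ (a i)) ∨
               (∃ u₀ : V.presheaf.stalk v, IsUnit u₀ ∧
                  Literature.AlgebraicGeometry.Motives.RatFn.functionFieldMap π g =
                    algebraMap (V.presheaf.stalk v) V.functionField u₀ ∧
                  ((∀ c : V.presheaf.stalk v, u₀ - c ^ p ∉ IsLocalRing.maximalIdeal (V.presheaf.stalk v)) ∨
                   (∃ c : V.presheaf.stalk v, u₀ - c ^ p ∈ IsLocalRing.maximalIdeal (V.presheaf.stalk v) ∧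
                      u₀ - c ^ p ∉ IsLocalRing.maximalIdeal (V.presheaf.stalk v) ^ 2))))) ∧
      (∀ p : ℕ, p.Prime → ∀ (k : Type) [Field k] [CharP k p], ¬ PerfectField k → ∀ (W : Scheme.{0}) [IsIntegral W]
        (f : W ⟶ Spec (.of k)) (L : Type) [Field L] [Algebra W.functionField L],
        IsSeparated f → LocallyOfFiniteType f → QuasiCompact f → Literature.AlgebraicGeometry.Resolution.Scheme.IsRegular W →
        IsPurelyInseparable W.functionField L → Module.finrank W.functionField L = p → ¬ topologicalKrullDim W ≤ 3 →
        ∃ (V : Scheme.{0}) (π : V ⟶ W) (_ : IsIntegral V) (_ : IsDominant π),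
          IsProper π ∧ Literature.AlgebraicGeometry.Resolution.IsBirational π ∧
          Literature.AlgebraicGeometry.Resolution.Scheme.IsRegular V ∧ ∀ v : V,
            ∃ (y : L) (g : W.functionField), y ∉ Set.range (algebraMap W.functionField L) ∧
              algebraMap W.functionField L g = y ^ p ∧
              ((∃ (d m : ℕ) (hmd : m ≤ d) (t : Fin d → V.presheaf.stalk v) (a : Fin m → ℕ),
                  Ideal.span (Set.range t) = IsLocalRing.maximalIdeal (V.presheaf.stalk v) ∧
                  ringKrullDim (V.presheaf.stalk v) = (d : WithBot ℕ∞) ∧ 0 < m ∧ (∀ i, ¬ p ∣ a i) ∧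
                  Literature.AlgebraicGeometry.Motives.RatFn.functionFieldMap π g =
                    ∏ i : Fin m, (algebraMap (V.presheaf.stalk v) V.functionField (t (Fin.castLE hmd i))) ^ (a i)) ∨
               (∃ u₀ : V.presheaf.stalk v, IsUnit u₀ ∧
                  Literature.AlgebraicGeometry.Motives.RatFn.functionFieldMap π g =
                    algebraMap (V.presheaf.stalk v) V.functionField u₀ ∧
                  ((∀ c : V.presheaf.stalk v, u₀ - c ^ p ∉ IsLocalRing.maximalIdeal (V.presheaf.stalk v)) ∨
                   (∃ c : V.presheaf.stalk v, u₀ - c ^ p ∈ IsLocalRing.maximalIdeal (V.presheaf.stalk v) ∧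
                      u₀ - c ^ p ∉ IsLocalRing.maximalIdeal (V.presheaf.stalk v) ^ 2))))) := by
  refine ⟨fun h => ⟨fun p hp k _ _ _ => h p hp k, fun p hp k _ _ _ => h p hp k⟩, fun h => ?_⟩
  intro p hp k _ _ W _ f L _ _ hs hl hq hr hpi hd hdim
  by_cases hk : PerfectField k
  · exact h.1 p hp k hk W f L hs hl hq hr hpi hd hdim
  · exact h.2 p hp k hk W f L hs hl hq hr hpi hd hdim

end Summit.ResolutionOfSingularities.ResolutionOfSingularities.Theorems

end
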